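import Literature.AnabelianGeometry.EtaleTheta.Discharge.Sec5Lem59vPinGalois
import Literature.AnabelianGeometry.EtaleTheta.Discharge.Sec5Rho219PinKummerShape
import HarnessLib

/-!
# [EtTh] Prop. 5.5 at `B_N` ⟺ Lemma 5.9 (v), §2 slot pinned — the EXISTENCE direction of the Prop. 5.5 clause on the v2 subquotient record
# `ThetaSubquotientProjGalois` (surjective at Galois objects only; proof-only)

Mochizuki, *The étale theta function and its Frobenioid-theoretic manifestations*, Publ. RIMS **45** (2009), Prop. 5.5 p. 327 (PDF p. 101)
(«the second Kummer class of Proposition 5.2, (iii), determines an isomorphism `(l·Δ_Θ)_S ⊗ ℤ/Nℤ ⥲ μ_N(S)`»), Lemma 5.9 (v) p. 332 (PDF p. 106)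
[cite: MochizukiEtTh2009, Prop 5.5 p.327 (PDF p.101)] [cite: MochizukiEtTh2009, Lem 5.9 (v) p.332 (PDF p.106)].

abc-iut cell, layer L2, seat abc-iut-w6-d079 (gen 6), row «PROJ-SURJ-PLAN-A» sequel «(w1e) PROP55-EXISTENCE ON v2» (self-proposed to
abc-iut-L2-lead gen 6).  PROOF-ONLY (0 definitions).  abc-iut-w4-d042's `Sec5Rho219PinKummerShape.lean` (p422255) re-run VERBATIM with the binder
`(P : ThetaSubquotientProj 𝔉)` (abc-iut-L2-t4's v1 record) replaced by `(P : ThetaSubquotientProjGalois 𝔉 Gal)` (abc-iut-w6-d079's v2 record,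
p481123, INHABITED at abc-iut-L2-t9's carriers by p481568) and the Prop. 5.5 clause read on the v2 record
(`ThetaSubquotientProjGalois.IsKummerDetermined`); the v1-typed `Δ`-leg predicate `IsDeltaLeg` is consumed INLINED.  Together with
`Sec5Lem59vPinGalois.lean` (p482077: the uniqueness / coincidence direction) this gives, on the INHABITED record, the full equivalence
«Kummer-determined at `B_N` ⟺ equal to the §2-pinned isomorphism».

* `rho219OfBiTheta_kummerShape_apply_galois`, `rho219OfBiTheta_kummerShape_galois` — the §2-pinned `ρ219` has the Kummer shape on
  `H_{B_N} ∩ pre`;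
* **`isKummerDetermined_of_eq_rho219OfBiTheta_galois`** — EXISTENCE: any family with `B_N`-component `ρ219` is Kummer-determined (v2 clause);
* **`isKummerDetermined_iff_cycRigidityCoincide_galois`** — the equivalence at `B_N` on the v2 record.

HONEST FRAMING: kernel-checked implications between the cell's typed statements; nothing asserts that such data exist for an actual curve;
[EtTh] is refereed; nothing here bears on [IUTchIII] Cor. 3.12 — no side taken; typed ≠ proved.
-/

noncomputable section

namespace Literature.AnabelianGeometry.EtaleTheta

open CategoryTheory
open FrobenioidCyclotomicRigidity

universe w v v' u u'

namespace ThetaFrobenioid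

variable {C : Type u} [Category.{v} C] {D : Type u'} [Category.{v'} D] (𝔉 : ThetaFrobenioid.{w} C D)
  (h1 : 𝔉.SectionsFactor) (h3 : 𝔉.OuterActionLZ) (hsec : 𝔉.SgpCapSection) (hcs : 𝔉.SgpCupSection)
  (h8 : 𝔉.ConstantsEqNormalizer) (DK : Set (TopOut 𝔉.EPiN))
  (T : ThetaEnvData.{v} 𝔉.N) (ι : 𝔉.PiX ≃ₜ* T.PiX)
  {η : T.PiYdd → T.mu} (hη : η ∈ T.thetaCocycles)
  (i : (𝔉.frdBiThetaEnv h1 h3 hsec hcs h8 DK).Iso (T.modelBi hη)) {Gal : D → Prop}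

/-- **The pinned §2 isomorphism has the Kummer shape, pointwise over `Δ`, on the v2 record** (abc-iut-w4-d042's
`rho219OfBiTheta_kummerShape_apply`, `P : ThetaSubquotientProjGalois 𝔉 Gal`, the `Δ`-leg law `IsDeltaLeg` INLINED as `hψ`).  For `y ∈ Π^tp_Ÿ̲` over `Δ` with `ρ y` in the
theta pre-subgroup, under the `Δ`-leg law: `ρ219[proj(ρ y)] = s^⊓-gp_N(ρ y) · s^⊔-gp_N(ρ y)⁻¹` in `μ_N(B_N) ⊆ Aut_C(B_N)`
— since `i(ρ219[proj(ρ y)], 1) = μ(ψ[proj(ρ y)]) = μ(η(ι y)) = i(s^⊓-Π_N(y) · s^⊔-Π_N(y)⁻¹)` and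
`s^⊓-Π_N(y) · s^⊔-Π_N(y)⁻¹ = (s^⊓-gp_N(ρ y) · s^⊔-gp_N(ρ y)⁻¹, 1)`. [cite: MochizukiEtTh2009, Prop 5.5 p.327 (PDF p.101); Lem 5.9 (v) p.332 (PDF p.106)] -/
theorem rho219OfBiTheta_kummerShape_apply_galois
    (hi : ∀ x : 𝔉.EPiN, ((CycEnvelope.proj T.augY T.chi (i.e x) : T.PiY) : T.PiX) = ι (𝔉.toPiY x))
    (hYdd : 𝔉.PiYdd.map ι.toMonoidHom = T.PiYdd) (P : ThetaSubquotientProjGalois 𝔉 Gal) (ψ : 𝔉.lDeltaModN 𝔉.BN ≃* T.mu)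
    (hψ : ∀ (y : 𝔉.PiYdd) (_ : T.aug (ι (y : 𝔉.PiX)) = 1)
      (hh : ((𝔉.rhoYdd y : 𝔉.HB) : Aut (𝔉.base.obj 𝔉.BN)) ∈ P.pre (𝔉.base.obj 𝔉.BN)),
      ψ (QuotientGroup.mk (P.proj _ ⟨_, hh⟩)) = η ⟨ι (y : 𝔉.PiX), 𝔉.iota_mem_PiYdd T ι hYdd y⟩) (y : 𝔉.PiYdd) (hy : T.aug (ι (y : 𝔉.PiX)) = 1)
    (hh : ((𝔉.rhoYdd y : 𝔉.HB) : Aut (𝔉.base.obj 𝔉.BN)) ∈ P.pre (𝔉.base.obj 𝔉.BN)) :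
    ((𝔉.rho219OfBiTheta h1 h3 hsec hcs h8 DK T ι hη i hi ψ (QuotientGroup.mk (P.proj _ ⟨_, hh⟩)) :
        𝔉.muTorsion 𝔉.BN 𝔉.N) : Aut 𝔉.BN) =
      𝔉.sgpCap (𝔉.ρ (y : 𝔉.PiX)) * (𝔉.sgpCup (𝔉.rhoYdd y))⁻¹ := by
  obtain ⟨u, hu⟩ := 𝔉.sCapPi_mul_sCupPi_inv_mem_range_muIncl h1 hsec hcs y
  have hufst : (u : Aut 𝔉.BN) = 𝔉.sgpCap (𝔉.ρ (y : 𝔉.PiX)) * (𝔉.sgpCup (𝔉.rhoYdd y))⁻¹ := by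
    have h := congrArg (fun e : 𝔉.EPiN => ((e : 𝔉.EPiN) : Aut 𝔉.BN × 𝔉.PiX).1) hu
    simp only [coe_muIncl, coe_sCapPi_mul_sCupPi_inv_fst] at h
    exact h
  have hiu : i.e (𝔉.muIncl u) = CycEnvelope.inMu T.augY T.chi (η ⟨ι (y : 𝔉.PiX), 𝔉.iota_mem_PiYdd T ι hYdd y⟩) := by
    rw [hu]
    exact 𝔉.biThetaIso_sCapPi_mul_sCupPi_inv h1 h3 hsec hcs h8 DK T ι hη i hi hYdd y hy
  have hiν := 𝔉.biThetaIso_muIncl_rho219OfBiTheta h1 h3 hsec hcs h8 DK T ι hη i hi ψ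
    (QuotientGroup.mk (P.proj _ ⟨_, hh⟩))
  rw [hψ y hy hh, ← hiu] at hiν
  have heq : 𝔉.rho219OfBiTheta h1 h3 hsec hcs h8 DK T ι hη i hi ψ (QuotientGroup.mk (P.proj _ ⟨_, hh⟩)) = u :=
    𝔉.muIncl_inj (i.e.injective hiν)
  rw [heq, hufst]

/-- **Prop. 5.5 at `B_N` for the §2-pinned isomorphism, from the row-2 laws, on the v2 record** (abc-iut-w4-d042's
`rho219OfBiTheta_kummerShape`): given (hlift) and (hP) (GAP G-w5d123-2)
and the bi-theta isomorphism, `ρ219 := rho219OfBiTheta ψ` satisfies the body of L2-t4's `IsKummerDetermined`: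
`∀ h ∈ H_{B_N} ∩ pre, ρ219[proj h] = s^⊓-gp_N(h) · s^⊔-gp_N(h)⁻¹`. [cite: MochizukiEtTh2009, Prop 5.5 p.327 (PDF p.101)] -/
theorem rho219OfBiTheta_kummerShape_galois {l : ℕ} (R : RigidData.{v} 𝔉.N l) (ι : 𝔉.PiX ≃ₜ* R.PiX)
    {η : R.PiYdd → R.mu} (hη : η ∈ R.thetaCocycles)
    (i : (𝔉.frdBiThetaEnv h1 h3 hsec hcs h8 DK).Iso (R.toThetaEnvData.modelBi hη))
    (hi : ∀ x : 𝔉.EPiN, ((CycEnvelope.proj R.augY R.chi (i.e x) : R.PiY) : R.PiX) = ι (𝔉.toPiY x))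
    (hYdd : 𝔉.PiYdd.map ι.toMonoidHom = R.PiYdd) (P : ThetaSubquotientProjGalois 𝔉 Gal) (ψ : 𝔉.lDeltaModN 𝔉.BN ≃* R.mu)
    (hlift : ∀ a ∈ 𝔉.HB, a ∈ P.pre (𝔉.base.obj 𝔉.BN) →
      ∃ k : 𝔉.PiYdd, ι (k : 𝔉.PiX) ∈ R.lDeltaTheta ∧ 𝔉.ρ (k : 𝔉.PiX) = a)
    (hP : ∀ (k : 𝔉.PiYdd) (hk : ι (k : 𝔉.PiX) ∈ R.lDeltaTheta) (hm : 𝔉.ρ (k : 𝔉.PiX) ∈ P.pre (𝔉.base.obj 𝔉.BN)),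
      (QuotientGroup.mk (P.proj _ ⟨𝔉.ρ (k : 𝔉.PiX), hm⟩) : 𝔉.lDeltaModN 𝔉.BN) =
        ψ.symm (R.thetaMod ⟨ι (k : 𝔉.PiX), hk⟩))
    (h : 𝔉.HB) (hh : (h : Aut (𝔉.base.obj 𝔉.BN)) ∈ P.pre (𝔉.base.obj 𝔉.BN)) :
    ((𝔉.rho219OfBiTheta h1 h3 hsec hcs h8 DK R.toThetaEnvData ι hη i hi ψ (QuotientGroup.mk (P.proj _ ⟨h, hh⟩)) :
        𝔉.muTorsion 𝔉.BN 𝔉.N) : Aut 𝔉.BN) =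
      𝔉.sgpCap (h : Aut (𝔉.base.obj 𝔉.BN)) * (𝔉.sgpCup h)⁻¹ := by
  obtain ⟨k, hk, hρ⟩ := hlift _ h.2 hh
  have hkh : 𝔉.rhoYdd k = h := Subtype.ext hρ
  subst hkh
  exact 𝔉.rho219OfBiTheta_kummerShape_apply_galois h1 h3 hsec hcs h8 DK R.toThetaEnvData ι hη i hi hYdd P ψ
    (𝔉.deltaLeg_of_rowTwo_galois h1 h3 hsec hcs h8 DK R ι hη i hi hYdd P ψ hlift hP) k
    (Subgroup.mem_inf.mp (R.lDeltaTheta_le hk)).2 hh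

/-- **The v2 Prop. 5.5 clause `ThetaSubquotientProjGalois.IsKummerDetermined` for any rigidity family with `B_N`-component `ρ219`**
(abc-iut-w4-d042's `isKummerDetermined_of_eq_rho219OfBiTheta` on the v2 record) (the EXISTENCE direction of
Prop. 5.5 at `B_N`, supplied by the §2 isomorphism through Lemma 5.9 (iv)). [cite: MochizukiEtTh2009, Prop 5.5 p.327 (PDF p.101)] -/
theorem isKummerDetermined_of_eq_rho219OfBiTheta_galois {l : ℕ} (R : RigidData.{v} 𝔉.N l) (ι : 𝔉.PiX ≃ₜ* R.PiX)
    {η : R.PiYdd → R.mu} (hη : η ∈ R.thetaCocycles)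
    (i : (𝔉.frdBiThetaEnv h1 h3 hsec hcs h8 DK).Iso (R.toThetaEnvData.modelBi hη))
    (hi : ∀ x : 𝔉.EPiN, ((CycEnvelope.proj R.augY R.chi (i.e x) : R.PiY) : R.PiX) = ι (𝔉.toPiY x))
    (hYdd : 𝔉.PiYdd.map ι.toMonoidHom = R.PiYdd) (P : ThetaSubquotientProjGalois 𝔉 Gal) (ψ : 𝔉.lDeltaModN 𝔉.BN ≃* R.mu)
    (hlift : ∀ a ∈ 𝔉.HB, a ∈ P.pre (𝔉.base.obj 𝔉.BN) →
      ∃ k : 𝔉.PiYdd, ι (k : 𝔉.PiX) ∈ R.lDeltaTheta ∧ 𝔉.ρ (k : 𝔉.PiX) = a)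
    (hP : ∀ (k : 𝔉.PiYdd) (hk : ι (k : 𝔉.PiX) ∈ R.lDeltaTheta) (hm : 𝔉.ρ (k : 𝔉.PiX) ∈ P.pre (𝔉.base.obj 𝔉.BN)),
      (QuotientGroup.mk (P.proj _ ⟨𝔉.ρ (k : 𝔉.PiX), hm⟩) : 𝔉.lDeltaModN 𝔉.BN) =
        ψ.symm (R.thetaMod ⟨ι (k : 𝔉.PiX), hk⟩))
    (ρf : RigidityFamily 𝔉) (hB : 𝔉.IsThetaSaturated 𝔉.BN)
    (hρf : 𝔉.CycRigidityCoincide (𝔉.rho219OfBiTheta h1 h3 hsec hcs h8 DK R.toThetaEnvData ι hη i hi ψ) ρf hB) :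
    P.IsKummerDetermined ρf hB := by
  intro h hh
  have happ : ρf 𝔉.BN hB (QuotientGroup.mk (P.proj _ ⟨h, hh⟩)) =
      𝔉.rho219OfBiTheta h1 h3 hsec hcs h8 DK R.toThetaEnvData ι hη i hi ψ (QuotientGroup.mk (P.proj _ ⟨h, hh⟩)) := by
    rw [hρf]
  rw [happ]
  exact 𝔉.rho219OfBiTheta_kummerShape_galois h1 h3 hsec hcs h8 DK R ι hη i hi hYdd P ψ hlift hP h hh

/-- **At `B_N`, on the v2 record: «Kummer-determined» ⟺ «equal to the §2-pinned isomorphism»** (abc-iut-w4-d042's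
`isKummerDetermined_iff_cycRigidityCoincide`) (Prop. 5.5's characterization ⟺ Lemma 5.9
(v)'s coincidence), given the bi-theta isomorphism of (iv) and the row-2 laws (hpre, hlift, hP).
[cite: MochizukiEtTh2009, Prop 5.5 p.327 (PDF p.101); Lem 5.9 (v) p.332 (PDF p.106)] -/
theorem isKummerDetermined_iff_cycRigidityCoincide_galois {l : ℕ} (R : RigidData.{v} 𝔉.N l) (ι : 𝔉.PiX ≃ₜ* R.PiX)
    {η : R.PiYdd → R.mu} (hη : η ∈ R.thetaCocycles)
    (i : (𝔉.frdBiThetaEnv h1 h3 hsec hcs h8 DK).Iso (R.toThetaEnvData.modelBi hη))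
    (hi : ∀ x : 𝔉.EPiN, ((CycEnvelope.proj R.augY R.chi (i.e x) : R.PiY) : R.PiX) = ι (𝔉.toPiY x))
    (hYdd : 𝔉.PiYdd.map ι.toMonoidHom = R.PiYdd) (P : ThetaSubquotientProjGalois 𝔉 Gal) (ψ : 𝔉.lDeltaModN 𝔉.BN ≃* R.mu)
    (hpre : ∀ k : 𝔉.PiYdd, ι (k : 𝔉.PiX) ∈ R.lDeltaTheta → 𝔉.ρ (k : 𝔉.PiX) ∈ P.pre (𝔉.base.obj 𝔉.BN))
    (hlift : ∀ a ∈ 𝔉.HB, a ∈ P.pre (𝔉.base.obj 𝔉.BN) →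
      ∃ k : 𝔉.PiYdd, ι (k : 𝔉.PiX) ∈ R.lDeltaTheta ∧ 𝔉.ρ (k : 𝔉.PiX) = a)
    (hP : ∀ (k : 𝔉.PiYdd) (hk : ι (k : 𝔉.PiX) ∈ R.lDeltaTheta) (hm : 𝔉.ρ (k : 𝔉.PiX) ∈ P.pre (𝔉.base.obj 𝔉.BN)),
      (QuotientGroup.mk (P.proj _ ⟨𝔉.ρ (k : 𝔉.PiX), hm⟩) : 𝔉.lDeltaModN 𝔉.BN) =
        ψ.symm (R.thetaMod ⟨ι (k : 𝔉.PiX), hk⟩))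
    (ρf : RigidityFamily 𝔉) (hB : 𝔉.IsThetaSaturated 𝔉.BN) :
    P.IsKummerDetermined ρf hB ↔
      𝔉.CycRigidityCoincide (𝔉.rho219OfBiTheta h1 h3 hsec hcs h8 DK R.toThetaEnvData ι hη i hi ψ) ρf hB :=
  ⟨fun hρf => 𝔉.cycRigidityCoincide_rho219OfBiTheta_of_rowTwo_galois h1 h3 hsec hcs h8 DK R ι hη i hi hYdd P ρf hB hρf ψ hpre
      hlift hP,
    fun hρf => 𝔉.isKummerDetermined_of_eq_rho219OfBiTheta_galois h1 h3 hsec hcs h8 DK R ι hη i hi hYdd P ψ hlift hP ρf hB hρf⟩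

end ThetaFrobenioid

end Literature.AnabelianGeometry.EtaleTheta

end
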